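import Literature.Topology.FourManifolds.Morse
import Mathlib.Geometry.Manifold.MFDeriv.Atlas
import Mathlib.Analysis.Normed.Module.FiniteDimension

/-!
# Morse functions: finiteness of the critical set (proofs)

This file discharges two named facts of `Literature/Topology/FourManifolds/Morse.lean`:

* `Literature.IsMorse.isClosed_criticalSet_holds : IsMorse.isClosed_criticalSet` — the critical set of a
  Morse function is closed (Milnor 1963, §2: continuity of `df`);
* `Literature.IsMorse.finite_criticalSet_holds : IsMorse.finite_criticalSet` — a Morse function on a
  compact manifold has finitely many critical points (Milnor 1963, Cor. 2.3 and the remark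
  following it; Matsumoto 2001, Cor. 2.19).

## Proof

Milnor deduces isolation of nondegenerate critical points from the Morse lemma (Lemma 2.2). We
avoid the Morse lemma: in the preferred chart at a critical point `p`, the coordinate expression
`Dg = fderivWithin ℝ (writtenInExtChartAt I 𝓘(ℝ, ℝ) p f) (range I)` of `df` vanishes at
`z₀ = extChartAt I p p`, is differentiable within `range I` there with derivative the Hessian
`L`, and `L` is injective (nondegeneracy), hence bounded below since the model space is
finite-dimensional. So `‖Dg z‖ ≥ ‖L (z - z₀)‖ - o(‖z - z₀‖) > 0` for `z ≠ z₀` near `z₀` in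
`range I`: critical points are isolated (this works verbatim on manifolds with boundary and
corners). The critical set is closed by continuity of `Dg`, hence compact, hence finite.

Finite-dimensionality of the model space is *not* assumed in the fact: we prove
(`Literature.Topology.FourManifolds.Manifold.finiteDimensional_of_compactSpace`) that a nonempty compact charted space forces
its model vector space to be locally compact, hence finite-dimensional (Riesz). Since `M` is not
assumed Hausdorff, the usual "compact ⇒ locally compact" is unavailable; instead we show that some
nonempty open set has closure inside a single chart domain
(`Literature.Topology.FourManifolds.Manifold.exists_isOpen_closure_subset_chart_source`), by taking a maximal set of charts of a
finite subcover with nonempty common intersection and shrinking once per chart.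

## References

* J. Milnor, *Morse theory*, Ann. of Math. Studies 51 (1963), §2, Lemma 2.2 and Cor. 2.3.
* Y. Matsumoto, *An introduction to Morse theory*, Transl. Math. Monographs 208, AMS (2001),
  Cor. 2.18, Cor. 2.19 (p. 60).
-/

open scoped Manifold ContDiff Topology
open Set Function Filter

noncomputable section

namespace Literature.Topology.FourManifolds

section Topology

variable {E H : Type*} [NormedAddCommGroup E] [NormedSpace ℝ E] [TopologicalSpace H]
  (I : ModelWithCorners ℝ E H) {M : Type*} [TopologicalSpace M] [ChartedSpace H M]

include I

/-- Shrinking step: inside a chart domain, a nonempty open set `A` contains a nonempty open `B`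
such that every point *of the chart domain* in the closure of `B` lies in `A` (regularity of the
model space, transported by the chart; no separation axiom on `M` is used). [folklore] -/
theorem Manifold.exists_isOpen_subset_forall_mem_closure (x : M) {A : Set M} (hA : IsOpen A)
    (hne : A.Nonempty) (hAx : A ⊆ (chartAt H x).source) :
    ∃ B : Set M, IsOpen B ∧ B.Nonempty ∧ B ⊆ A ∧
      ∀ y ∈ (chartAt H x).source, y ∈ closure B → y ∈ A := by
  obtain ⟨p, hp⟩ := hne
  have hps : p ∈ (extChartAt I x).source := by rw [extChartAt_source]; exact hAx hp
  have h1 : (extChartAt I x).symm ⁻¹' A ∈ 𝓝 (extChartAt I x p) :=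
    extChartAt_preimage_mem_nhds' hps (hA.mem_nhds hp)
  obtain ⟨ε, εpos, hε⟩ := Metric.nhds_basis_closedBall.mem_iff.1 h1
  refine ⟨(extChartAt I x).source ∩ extChartAt I x ⁻¹' Metric.ball (extChartAt I x p) ε,
    isOpen_extChartAt_preimage' x Metric.isOpen_ball, ⟨p, hps, Metric.mem_ball_self εpos⟩,
    ?_, ?_⟩
  · rintro y ⟨hys, hy⟩
    have := hε (Metric.ball_subset_closedBall hy)
    rwa [mem_preimage, (extChartAt I x).left_inv hys] at this
  · intro y hy hcl
    rw [← extChartAt_source I] at hy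
    have hcont : ContinuousWithinAt (extChartAt I x)
        ((extChartAt I x).source ∩ extChartAt I x ⁻¹' Metric.ball (extChartAt I x p) ε) y :=
      (continuousAt_extChartAt' hy).continuousWithinAt
    have hmem := hcont.mem_closure_image hcl
    have hball : extChartAt I x y ∈ Metric.closedBall (extChartAt I x p) ε := by
      refine Metric.closure_ball_subset_closedBall (closure_mono ?_ hmem)
      rintro _ ⟨z, ⟨-, hz⟩, rfl⟩
      exact hz
    have := hε hball
    rwa [mem_preimage, (extChartAt I x).left_inv hy] at this

/-- Iterated shrinking over a finite set `S` of charts containing `A`. [folklore] -/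
theorem Manifold.exists_isOpen_subset_forall_mem_closure_finset (S : Finset M) :
    ∀ {A : Set M}, IsOpen A → A.Nonempty → (∀ x ∈ S, A ⊆ (chartAt H x).source) →
    ∃ B : Set M, IsOpen B ∧ B.Nonempty ∧ B ⊆ A ∧
      ∀ x ∈ S, ∀ y ∈ (chartAt H x).source, y ∈ closure B → y ∈ A := by
  classical
  induction S using Finset.induction_on with
  | empty =>
    intro A hA hne _
    exact ⟨A, hA, hne, Subset.rfl, fun x hx => by simp at hx⟩
  | insert x S hxS ih =>
    intro A hA hne hS
    obtain ⟨B₁, hB₁, hne₁, hB₁A, h₁⟩ :=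
      ih hA hne fun x' hx' => hS x' (Finset.mem_insert_of_mem hx')
    obtain ⟨B₂, hB₂, hne₂, hB₂B₁, h₂⟩ :=
      Manifold.exists_isOpen_subset_forall_mem_closure I x hB₁ hne₁
        (hB₁A.trans (hS x (Finset.mem_insert_self x S)))
    refine ⟨B₂, hB₂, hne₂, hB₂B₁.trans hB₁A, fun x' hx' y hy hcl => ?_⟩
    rcases Finset.mem_insert.1 hx' with rfl | hx'
    · exact hB₁A (h₂ y hy hcl)
    · exact h₁ x' hx' y hy (closure_mono hB₂B₁ hcl)

variable (M) in
/-- In a nonempty compact charted space (no separation axiom assumed) some nonempty open set has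
its closure inside a single chart domain. [folklore] -/
theorem Manifold.exists_isOpen_closure_subset_chart_source [CompactSpace M] [Nonempty M] :
    ∃ (x : M) (B : Set M), IsOpen B ∧ B.Nonempty ∧ closure B ⊆ (chartAt H x).source := by
  classical
  obtain ⟨t, ht⟩ := CompactSpace.elim_nhds_subcover (fun x : M => (chartAt H x).source)
    fun x => (chartAt H x).open_source.mem_nhds (mem_chart_source H x)
  set P : Finset (Finset M) :=
    t.powerset.filter (fun S => (⋂ x ∈ S, (chartAt H x).source).Nonempty) with hP
  obtain ⟨x₀⟩ := ‹Nonempty M›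
  have hx₀ : x₀ ∈ ⋃ x ∈ t, (chartAt H x).source := by rw [ht]; exact mem_univ _
  obtain ⟨x₁, hx₁t, -⟩ := mem_iUnion₂.1 hx₀
  have hP₁ : ({x₁} : Finset M) ∈ P := by
    rw [hP, Finset.mem_filter, Finset.mem_powerset]
    refine ⟨Finset.singleton_subset_iff.2 hx₁t, ⟨x₁, ?_⟩⟩
    simp
  obtain ⟨S, hSP, hSmax⟩ := Finset.exists_max_image P Finset.card ⟨{x₁}, hP₁⟩
  rw [hP, Finset.mem_filter, Finset.mem_powerset] at hSP
  obtain ⟨hSt, hOne⟩ := hSP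
  set O : Set M := ⋂ x ∈ S, (chartAt H x).source with hO
  have hOopen : IsOpen O := isOpen_biInter_finset fun x _ => (chartAt H x).open_source
  -- maximality: a chart of the cover meeting `O` belongs to `S`
  have hkey : ∀ x ∈ t, (O ∩ (chartAt H x).source).Nonempty → x ∈ S := by
    intro x hxt hxO
    by_contra hxS
    have hins : insert x S ∈ P := by
      rw [hP, Finset.mem_filter, Finset.mem_powerset]
      refine ⟨Finset.insert_subset hxt hSt, ?_⟩
      rw [Finset.set_biInter_insert, inter_comm]
      exact hxO
    have := hSmax _ hins
    rw [Finset.card_insert_of_notMem hxS] at this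
    omega
  have hScard : 1 ≤ S.card := by simpa using hSmax _ hP₁
  obtain ⟨x, hxS⟩ := Finset.card_pos.1 hScard
  obtain ⟨B, hB, hBne, hBO, hcl⟩ :=
    Manifold.exists_isOpen_subset_forall_mem_closure_finset I S hOopen hOne
      (fun x hx => biInter_subset_of_mem hx)
  refine ⟨x, B, hB, hBne, fun y hy => ?_⟩
  have hyU : y ∈ ⋃ x ∈ t, (chartAt H x).source := by rw [ht]; exact mem_univ _
  obtain ⟨x', hx't, hyx'⟩ := mem_iUnion₂.1 hyU
  have hmeet : (O ∩ (chartAt H x').source).Nonempty := by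
    obtain ⟨z, hzs, hzB⟩ := mem_closure_iff.1 hy _ (chartAt H x').open_source hyx'
    exact ⟨z, hBO hzB, hzs⟩
  exact biInter_subset_of_mem hxS (hcl x' (hkey x' hx't hmeet) y hyx' hy)

variable (M) in
/-- The model vector space of a nonempty compact charted space is locally compact (no separation
axiom on `M` assumed). [folklore] -/
theorem Manifold.locallyCompactSpace_of_compactSpace [CompactSpace M] [Nonempty M] :
    LocallyCompactSpace E := by
  obtain ⟨x, B, hB, hBne, hcl⟩ := Manifold.exists_isOpen_closure_subset_chart_source I M
  have hKc : IsCompact (extChartAt I x '' closure B) :=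
    isClosed_closure.isCompact.image_of_continuousOn
      ((continuousOn_extChartAt x).mono (by rwa [extChartAt_source]))
  obtain ⟨p, hp⟩ := hBne
  have hps : p ∈ (extChartAt I x).source := by
    rw [extChartAt_source]; exact hcl (subset_closure hp)
  have h1 : (extChartAt I x).symm ⁻¹' B ∈ 𝓝 (extChartAt I x p) :=
    extChartAt_preimage_mem_nhds' hps (hB.mem_nhds hp)
  have h2 : extChartAt I x p ∈ closure (interior (extChartAt I x).target) :=
    extChartAt_target_subset_closure_interior ((extChartAt I x).map_source hps)
  obtain ⟨w, hw₁, hw₂⟩ := mem_closure_iff_nhds.1 h2 _ (interior_mem_nhds.2 h1)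
  apply hKc.locallyCompactSpace_of_mem_nhds_of_addGroup (x := w)
  filter_upwards [isOpen_interior.mem_nhds hw₁, isOpen_interior.mem_nhds hw₂] with z hz₁ hz₂
  have hzB : z ∈ (extChartAt I x).symm ⁻¹' B := interior_subset hz₁
  exact ⟨(extChartAt I x).symm z, subset_closure hzB,
    (extChartAt I x).right_inv (interior_subset hz₂)⟩

variable (M) in
/-- The model vector space of a nonempty compact (real) charted space is finite-dimensional
(Riesz; converse direction of `Manifold.locallyCompact_of_finiteDimensional`, without any
separation axiom on `M`). [folklore] -/
theorem Manifold.finiteDimensional_of_compactSpace [CompactSpace M] [Nonempty M] :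
    FiniteDimensional ℝ E := by
  have := Manifold.locallyCompactSpace_of_compactSpace I M
  exact FiniteDimensional.of_locallyCompactSpace ℝ

end Topology

section Critical

variable {E H : Type*} [NormedAddCommGroup E] [NormedSpace ℝ E] [TopologicalSpace H]
  {I : ModelWithCorners ℝ E H} {M : Type*} [TopologicalSpace M] [ChartedSpace H M]

/-- Chain rule in a fixed chart: the derivative of `f` written in the extended chart at `x₀`,
at the image of a point `y` of the chart domain, is `df_y` composed with the (invertible)
derivative of the inverse chart. [folklore] -/
theorem fderivWithin_writtenInExtChartAt_eq_comp [IsManifold I 1 M] {f : M → ℝ} {x₀ y : M}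
    (hy : y ∈ (extChartAt I x₀).source) (hf : MDifferentiableAt I 𝓘(ℝ, ℝ) f y) :
    fderivWithin ℝ (writtenInExtChartAt I 𝓘(ℝ, ℝ) x₀ f) (range I) (extChartAt I x₀ y) =
      (mfderiv I 𝓘(ℝ, ℝ) f y).comp
        (mfderivWithin 𝓘(ℝ, E) I (extChartAt I x₀).symm (range I) (extChartAt I x₀ y)) := by
  have hy' : extChartAt I x₀ y ∈ (extChartAt I x₀).target := (extChartAt I x₀).map_source hy
  have hw : writtenInExtChartAt I 𝓘(ℝ, ℝ) x₀ f = f ∘ (extChartAt I x₀).symm := by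
    ext z; simp [writtenInExtChartAt]
  rw [← mfderivWithin_eq_fderivWithin, hw]
  exact mfderiv_comp_mfderivWithin_of_eq hf (mdifferentiableWithinAt_extChartAt_symm hy')
    (I.uniqueMDiffOn _ (extChartAt_target_subset_range x₀ hy')) ((extChartAt I x₀).left_inv hy)

/-- A point `y` of the chart domain of `x₀` is critical for `f` iff the derivative of `f` written
in the extended chart at `x₀` vanishes at the image of `y` (Milnor 1963, §2: criticality is read
in any local coordinate system). [folklore] -/
theorem isMCriticalPt_iff_fderivWithin_writtenInExtChartAt_eq_zero [IsManifold I 1 M] {f : M → ℝ}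
    {x₀ y : M} (hy : y ∈ (extChartAt I x₀).source) (hf : MDifferentiableAt I 𝓘(ℝ, ℝ) f y) :
    IsMCriticalPt I f y ↔
      fderivWithin ℝ (writtenInExtChartAt I 𝓘(ℝ, ℝ) x₀ f) (range I) (extChartAt I x₀ y) = 0 := by
  rw [IsMCriticalPt, fderivWithin_writtenInExtChartAt_eq_comp hy hf]
  obtain ⟨e, he⟩ := isInvertible_mfderivWithin_extChartAt_symm ((extChartAt I x₀).map_source hy)
  constructor
  · intro h
    ext v
    rw [ContinuousLinearMap.comp_apply, h]
    rfl
  · intro h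
    have hsurj : Function.Surjective
        (mfderivWithin 𝓘(ℝ, E) I (extChartAt I x₀).symm (range I) (extChartAt I x₀ y)) := by
      rw [← he]; exact e.surjective
    ext v
    obtain ⟨w, rfl⟩ := hsurj v
    exact ContinuousLinearMap.ext_iff.1 h w

/-- For a `C^n` function, `n ≥ 2`, the coordinate expression of `df` in the extended chart at `x₀`
is `C¹` within `range I` at the image of every point of the chart domain. [folklore] -/
theorem contDiffWithinAt_fderivWithin_writtenInExtChartAt {n : WithTop ℕ∞} [IsManifold I n M]
    {f : M → ℝ} (hf : ContMDiff I 𝓘(ℝ, ℝ) n f) (hn : 2 ≤ n) {x₀ y : M}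
    (hy : y ∈ (chartAt H x₀).source) :
    ContDiffWithinAt ℝ 1 (fderivWithin ℝ (writtenInExtChartAt I 𝓘(ℝ, ℝ) x₀ f) (range I))
      (range I) (extChartAt I x₀ y) := by
  have h := ((contMDiffAt_iff_of_mem_source (I' := 𝓘(ℝ, ℝ)) (n := n) (y := f x₀) hy
    (by simp)).1 (hf y)).2
  refine h.fderivWithin_right I.uniqueDiffOn ?_ ?_
  · rw [one_add_one_eq_two]; exact hn
  · rw [extChartAt_coe]; exact mem_range_self _

/-- The critical set of a `C^n` function, `n ≥ 2`, is closed (Milnor 1963, §2; continuity of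
`df` in charts). [cite: Milnor1963, §2] -/
theorem isClosed_criticalSet_of_contMDiff {n : WithTop ℕ∞} [IsManifold I n M] {f : M → ℝ}
    (hf : ContMDiff I 𝓘(ℝ, ℝ) n f) (hn : 2 ≤ n) : IsClosed (criticalSet I f) := by
  have hn1 : (1 : WithTop ℕ∞) ≤ n := le_trans (by norm_num) hn
  have hn0 : n ≠ 0 := by rintro rfl; exact absurd hn1 (by norm_num)
  haveI : IsManifold I 1 M := IsManifold.of_le (n := n) hn1
  refine isClosed_of_closure_subset fun x₀ hx₀ => ?_
  set φ := extChartAt I x₀ with hφ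
  set Dg := fderivWithin ℝ (writtenInExtChartAt I 𝓘(ℝ, ℝ) x₀ f) (range I) with hDg
  have hcont : ContinuousWithinAt Dg (range I) (φ x₀) :=
    (contDiffWithinAt_fderivWithin_writtenInExtChartAt hf hn
      (mem_chart_source H x₀)).continuousWithinAt
  have h1 : x₀ ∈ closure (φ.source ∩ criticalSet I f) :=
    (isOpen_extChartAt_source x₀).inter_closure ⟨mem_extChartAt_source x₀, hx₀⟩
  have h2 : φ x₀ ∈ closure (φ '' (φ.source ∩ criticalSet I f)) :=
    (continuousAt_extChartAt x₀).continuousWithinAt.mem_closure_image h1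
  have h3 : φ '' (φ.source ∩ criticalSet I f) ⊆ range I ∩ {z | Dg z = 0} := by
    rintro _ ⟨y, ⟨hys, hyC⟩, rfl⟩
    exact ⟨extChartAt_target_subset_range _ (φ.map_source hys),
      (isMCriticalPt_iff_fderivWithin_writtenInExtChartAt_eq_zero hys
        (hf.mdifferentiableAt hn0)).1 hyC⟩
  have h4 : Dg (φ x₀) ∈ closure (Dg '' (range I ∩ {z | Dg z = 0})) :=
    (hcont.mono inter_subset_left).mem_closure_image (closure_mono h3 h2)
  have h5 : Dg '' (range I ∩ {z | Dg z = 0}) ⊆ {0} := by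
    rintro _ ⟨z, ⟨-, hz⟩, rfl⟩; exact hz
  have h6 : Dg (φ x₀) = 0 := by
    have := closure_mono h5 h4
    rwa [closure_singleton, mem_singleton_iff] at this
  exact (isMCriticalPt_iff_fderivWithin_writtenInExtChartAt_eq_zero (mem_extChartAt_source x₀)
    (hf.mdifferentiableAt hn0)).2 h6

/-- **Nondegenerate critical points are isolated** (Milnor 1963, Cor. 2.3; Matsumoto 2001,
Cor. 2.18), for a `C^n` function (`n ≥ 2`) on a manifold (possibly with boundary and corners)
modelled on a finite-dimensional space: near a critical point `p` with nondegenerate Hessian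
there is no other critical point. [cite: Milnor1963, Cor. 2.3] -/
theorem eventually_not_isMCriticalPt_of_nondegenerate [FiniteDimensional ℝ E] {n : WithTop ℕ∞}
    [IsManifold I n M] {f : M → ℝ} (hf : ContMDiff I 𝓘(ℝ, ℝ) n f) (hn : 2 ≤ n) {p : M}
    (hp : IsMCriticalPt I f p) (hH : (mhessian I f p).Nondegenerate) :
    ∀ᶠ x in 𝓝[≠] p, ¬ IsMCriticalPt I f x := by
  have hn1 : (1 : WithTop ℕ∞) ≤ n := le_trans (by norm_num) hn
  have hn0 : n ≠ 0 := by rintro rfl; exact absurd hn1 (by norm_num)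
  haveI : IsManifold I 1 M := IsManifold.of_le (n := n) hn1
  set φ := extChartAt I p with hφ
  set Dg := fderivWithin ℝ (writtenInExtChartAt I 𝓘(ℝ, ℝ) p f) (range I) with hDg
  set z₀ := φ p with hz₀
  have hcd : ContDiffWithinAt ℝ 1 Dg (range I) z₀ :=
    contDiffWithinAt_fderivWithin_writtenInExtChartAt hf hn (mem_chart_source H p)
  set L : E →L[ℝ] (E →L[ℝ] ℝ) := fderivWithin ℝ Dg (range I) z₀ with hL
  have hderiv : HasFDerivWithinAt Dg L (range I) z₀ :=
    (hcd.differentiableWithinAt one_ne_zero).hasFDerivWithinAt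
  -- the Hessian `mhessian I f p` is `L` viewed as a bilinear form; nondegeneracy ⇒ `L` injective
  have hker : LinearMap.ker (L : E →ₗ[ℝ] (E →L[ℝ] ℝ)) = ⊥ := by
    rw [LinearMap.ker_eq_bot']
    intro v hv
    refine hH.1 v fun w => ?_
    change L v w = 0
    rw [show L v = 0 from hv]; rfl
  obtain ⟨K, Kpos, hK⟩ := (L : E →ₗ[ℝ] (E →L[ℝ] ℝ)).exists_antilipschitzWith hker
  have hDg0 : Dg z₀ = 0 :=
    (isMCriticalPt_iff_fderivWithin_writtenInExtChartAt_eq_zero (mem_extChartAt_source p)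
      (hf.mdifferentiableAt hn0)).1 hp
  have hKinv : (0 : ℝ) < (K : ℝ)⁻¹ / 2 := by positivity
  have h1 : ∀ᶠ z in 𝓝[range I] z₀, ‖Dg z - Dg z₀ - L (z - z₀)‖ ≤ (K : ℝ)⁻¹ / 2 * ‖z - z₀‖ :=
    hderiv.isLittleO.def hKinv
  have h2 : ∀ᶠ z in 𝓝[range I] z₀, z ≠ z₀ → Dg z ≠ 0 := by
    filter_upwards [h1] with z hz hne hDgz
    rw [hDgz, hDg0, sub_zero, zero_sub, norm_neg] at hz
    have hanti : ‖z - z₀‖ ≤ K * ‖L (z - z₀)‖ := by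
      simpa [dist_eq_norm] using hK.le_mul_dist (z - z₀) 0
    have hpos : 0 < ‖z - z₀‖ := norm_pos_iff.2 (sub_ne_zero.2 hne)
    have hKp : (0 : ℝ) < K := by exact_mod_cast Kpos
    have : ‖z - z₀‖ ≤ ‖z - z₀‖ / 2 :=
      calc ‖z - z₀‖ ≤ K * ‖L (z - z₀)‖ := hanti
        _ ≤ K * ((K : ℝ)⁻¹ / 2 * ‖z - z₀‖) := by gcongr
        _ = ‖z - z₀‖ / 2 := by field_simp
    linarith
  -- pull back to `M` along the chart
  have hφt : Tendsto φ (𝓝 p) (𝓝[range I] z₀) :=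
    tendsto_nhdsWithin_iff.2 ⟨continuousAt_extChartAt p,
      Eventually.of_forall fun x => by rw [hφ, extChartAt_coe]; exact mem_range_self _⟩
  have h3 := hφt.eventually h2
  have h4 : ∀ᶠ x in 𝓝 p, x ∈ φ.source := extChartAt_source_mem_nhds p
  rw [eventually_nhdsWithin_iff]
  filter_upwards [h3, h4] with x hx hxs hxp hcrit
  have hne : φ x ≠ z₀ := fun h => hxp (φ.injOn hxs (mem_extChartAt_source p) h)
  exact hx hne ((isMCriticalPt_iff_fderivWithin_writtenInExtChartAt_eq_zero hxs
    (hf.mdifferentiableAt hn0)).1 hcrit)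

/-- Discharge of `IsMorse.isClosed_criticalSet`: the critical set of a Morse function is closed
(Milnor 1963, §2). [cite: Milnor1963, §2] -/
theorem IsMorse.isClosed_criticalSet_holds : IsMorse.isClosed_criticalSet (I := I) (M := M) := by
  intro _ f hf
  exact isClosed_criticalSet_of_contMDiff hf.1 (by norm_cast)

/-- Discharge of `IsMorse.finite_criticalSet`: a Morse function on a compact manifold (possibly
with boundary and corners; no separation axiom and no finite-dimensionality assumed, the latter
being automatic) has finitely many critical points (Milnor 1963, Cor. 2.3 and the remark following
it; Matsumoto 2001, Cor. 2.19). [cite: Milnor1963, Cor. 2.3] -/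
theorem IsMorse.finite_criticalSet_holds : IsMorse.finite_criticalSet (I := I) (M := M) := by
  intro _ _ f hf
  rcases isEmpty_or_nonempty M with hM | hM
  · exact Set.toFinite _
  haveI := Manifold.finiteDimensional_of_compactSpace I M
  have h2 : (2 : WithTop ℕ∞) ≤ ∞ := by norm_cast
  have hcpt : IsCompact (criticalSet I f) := (isClosed_criticalSet_of_contMDiff hf.1 h2).isCompact
  obtain ⟨t, -, hcover⟩ := hcpt.elim_nhds_subcover (fun p => {x | x = p ∨ ¬ IsMCriticalPt I f x})
    fun p hp => by
      have := eventually_not_isMCriticalPt_of_nondegenerate hf.1 h2 hp (hf.2 p hp)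
      rw [eventually_nhdsWithin_iff] at this
      filter_upwards [this] with x hx
      by_cases hxp : x = p
      · exact Or.inl hxp
      · exact Or.inr (hx hxp)
  refine t.finite_toSet.subset fun x hx => ?_
  obtain ⟨p, hpt, hxp⟩ := mem_iUnion₂.1 (hcover hx)
  rcases hxp with rfl | h
  · exact hpt
  · exact absurd hx h

end Critical

end Literature.Topology.FourManifolds
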